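import Summits.MatrixMultiplication.OmegaCensus.DominoLineUnitObstruction
import Summits.MatrixMultiplication.OmegaCensus.ThreeSetLineCertificate
import HarnessLib

/-!
# The local (one-prime) obstruction to the THREE-SET line identity, in any commutative ring

ω-census `pub-omega`, family (b3), seat pub-omega-group gen 41.  Framing: lottery ticket; floor = certified bounds/negative
ranges.  VALUE: a kernel TOOL for the three-set cube cells `(4, d, e)@p²` of the Dih-side law census (the `|W| ≥ 2` analogue of
`DominoLineUnitObstruction`, which is the case `W = {0}`): the algebra behind a TWO-NUMBER certificate `(ℓ, r)` per `X`-datum that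
replaces the `p × p` modular Farkas / spectral dual vectors of `ThreeSetLineFarkas*`; NOT progress on ω and not a proof of LINE
LEMMA (β) (`ThreeSetZpPencil4`) — the certificates stay per datum, they only get ≈ 10× cheaper to state and to check.

Setting (`ThreeSetLineCertificate.lineMat3`): `W F G : ZMod p → ℕ`, `s`, `K` with the three-set line identity
`Σ_u (Σ_v W(v)·(F(τ−u+v) + F(v+u−τ) + F(τ+u−v)))·G(u) + [s = τ] = K` for every `τ : ZMod p` (`p` prime).
Let `R` be any commutative ring and `r : R` with `Σ_{i<p} r^i = 0`; write `w = Σ W(v) r^v`, `w̄ = Σ W(v) r^{−v}` (`lev`, `levc` of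
`DominoLineUnitObstruction`), `x, x̄, y, ȳ` likewise, `ρ = r^s`, `ρ̄ = r^{−s}`.
* `line_char_identity3`: **`w̄xy + wx̄y + wxȳ + ρ = 0`** (multiply the identity at `τ` by `r^τ` and sum); applied to `r^{p−1}` it
  gives the conjugate identity `wx̄ȳ + w̄xȳ + w̄x̄y + ρ̄ = 0` (`line_char_identity3_conj`).
* `threeD_mul_threeD`: the polynomial identity `D(xw̄, x̄w)·D(yw̄, ȳw) = w̄²u² − ww̄·uū + w²ū²` (`D(a, b) = a² + ab + b²`,
  `u = w̄xy + wx̄y + wxȳ`, `ū = wx̄ȳ + w̄xȳ + w̄x̄y`) — the three-set form of `DominoNorm.Dsh_mul_Dsh` /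
  `ThreeSetNorm.D_mul_D` (there over `ℂ`), here by `ring` in any commutative ring.
* consequences on solutions (`threeD_mul_threeD_eq`, `threeD_mul_lev_eq`, `threeD_mul_levc_eq`): with `D_X := D(xw̄, x̄w) = (xw̄)² + (xw̄)(x̄w) + (x̄w)²`,
  `τ_X := xw̄ + x̄w`:  `D_X · D_Y = w̄²ρ² − ww̄ + w²ρ̄²` (=: `Γ_s`),  `D_X · y = ρ̄·wx − ρ·τ_X`,  `D_X · ȳ = ρ·w̄x̄ − ρ̄·τ_X`
  (the mate formula of `ThreeSetCharacterIdentities`, ring version).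
* **`no_line_identity3_of_local`**: hence if `D_X = 0` in `R` while one of `Γ_s`, `ρ̄·wx − ρ·τ_X`, `ρ·w̄x̄ − ρ̄·τ_X` is non-zero,
  the identity has NO solution `G` with this hole `s` (any `K`, any bound on `G`).  Taking `R = 𝔽_ℓ` or `𝔽_ℓ[√D]` (a prime `ℓ ≡ ±1
  (mod p)` below a prime ideal dividing `D_X` in `ℤ[ζ_p]⁺`) this is exactly the information carried by one modular dual vector
  at one frequency pair; the `Bool` certificate checker is `ThreeSetLineUnitCertificate`.
-/

namespace Summit.MatrixMultiplication.OmegaCensus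

open Finset

namespace LineUnit

section Character

variable {p : ℕ} [Fact p.Prime] {R : Type*} [CommRing R]

/-- A translated character sum: `Σ_τ F(τ + c)·g·r^τ = x · g · r^{−c}`. [folklore] -/
theorem sum_shift_zch {r : R} (h : r ^ p = 1) (F : ZMod p → ℕ) (c : ZMod p) (g : R) :
    ∑ τ : ZMod p, (F (τ + c) : R) * g * zch r τ = lev r F * g * zch r (-c) := by
  unfold lev
  rw [sum_mul, sum_mul]
  refine Fintype.sum_equiv (Equiv.addRight c) _ _ fun τ => ?_
  rw [Equiv.coe_addRight, show zch r τ = zch r (τ + c) * zch r (-c) by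
    rw [← zch_add h, add_neg_cancel_right]]
  ring

/-- A reflected character sum: `Σ_τ F(c − τ)·g·r^τ = x̄ · g · r^{c}`. [folklore] -/
theorem sum_reflect_zch {r : R} (h : r ^ p = 1) (F : ZMod p → ℕ) (c : ZMod p) (g : R) :
    ∑ τ : ZMod p, (F (c - τ) : R) * g * zch r τ = levc r F * g * zch r c := by
  unfold levc
  rw [sum_mul, sum_mul]
  refine Fintype.sum_equiv (Equiv.subLeft c) _ _ fun τ => ?_
  rw [Equiv.subLeft_apply, show zch r τ = zch r (-(c - τ)) * zch r c by
    rw [← zch_add h, neg_sub, sub_add_cancel]]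
  ring

/-- Factoring a double sum of products: `Σ_u Σ_v f(v)·g(u)·X = (Σ f)·(Σ g)·X`. [folklore] -/
theorem sum_sum_factor (f g : ZMod p → R) (X : R) :
    ∑ u : ZMod p, ∑ v : ZMod p, f v * g u * X = (∑ v : ZMod p, f v) * (∑ u : ZMod p, g u) * X := by
  rw [sum_mul_sum, sum_mul, sum_comm]
  refine sum_congr rfl fun u _ => ?_
  rw [sum_mul]

/-- **The three-set line identity through the character `v ↦ r^v`**: `w̄xy + wx̄y + wxȳ + r^s = 0`. [folklore] -/
theorem line_char_identity3 {r : R} (hr : ∑ i ∈ range p, r ^ i = 0) (W F G : ZMod p → ℕ) (s : ZMod p) (K : ℕ)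
    (hid : ∀ τ : ZMod p, (∑ u : ZMod p, lineMat3 W F τ u * G u) + (if s = τ then 1 else 0) = K) :
    levc r W * lev r F * lev r G + lev r W * levc r F * lev r G + lev r W * lev r F * levc r G + zch r s = 0 := by
  have h1 := pow_eq_one_of_geom_sum_eq_zero hr
  -- the identity at `τ`, cast to `R` and multiplied by `r^τ`
  have key : ∀ τ : ZMod p,
      (∑ u : ZMod p, ∑ v : ZMod p, (W v : R) * G u * ((F (τ + (v - u)) : R) * 1 * zch r τ)) +
      (∑ u : ZMod p, ∑ v : ZMod p, (W v : R) * G u * ((F ((v + u) - τ) : R) * 1 * zch r τ)) +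
      (∑ u : ZMod p, ∑ v : ZMod p, (W v : R) * G u * ((F (τ + (u - v)) : R) * 1 * zch r τ)) +
      (if s = τ then (1 : R) else 0) * zch r τ = (K : R) * zch r τ := by
    intro τ
    have h := congrArg (fun n : ℕ => (n : R) * zch r τ) (hid τ)
    simp only [lineMat3] at h
    push_cast at h
    rw [← h, add_mul, sum_mul]
    congr 1
    rw [← sum_add_distrib, ← sum_add_distrib]
    refine sum_congr rfl fun u _ => ?_
    rw [sum_mul, sum_mul, ← sum_add_distrib, ← sum_add_distrib]
    refine sum_congr rfl fun v _ => ?_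
    rw [show τ + (v - u) = τ - u + v by abel, show τ + (u - v) = τ + u - v by abel]
    ring
  have hsum := sum_congr rfl fun τ (_ : τ ∈ (univ : Finset (ZMod p))) => key τ
  rw [← mul_sum, sum_zch, hr, mul_zero, sum_add_distrib, sum_add_distrib, sum_add_distrib] at hsum
  -- the three triple sums
  have e1 : ∑ τ : ZMod p, ∑ u : ZMod p, ∑ v : ZMod p, (W v : R) * G u * ((F (τ + (v - u)) : R) * 1 * zch r τ) =
      levc r W * lev r F * lev r G := by
    rw [sum_comm]
    have hu : ∀ u : ZMod p, ∑ τ : ZMod p, ∑ v : ZMod p, (W v : R) * G u * ((F (τ + (v - u)) : R) * 1 * zch r τ) =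
        ∑ v : ZMod p, (W v : R) * zch r (-v) * ((G u : R) * zch r u) * lev r F := by
      intro u
      rw [sum_comm]
      refine sum_congr rfl fun v _ => ?_
      rw [← mul_sum, sum_shift_zch h1, neg_sub, show zch r (u - v) = zch r u * zch r (-v) by
        rw [← zch_add h1, sub_eq_add_neg]]
      ring
    rw [sum_congr rfl fun u _ => hu u, sum_sum_factor]
    unfold levc lev
    ring
  have e2 : ∑ τ : ZMod p, ∑ u : ZMod p, ∑ v : ZMod p, (W v : R) * G u * ((F ((v + u) - τ) : R) * 1 * zch r τ) =
      lev r W * levc r F * lev r G := by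
    rw [sum_comm]
    have hu : ∀ u : ZMod p, ∑ τ : ZMod p, ∑ v : ZMod p, (W v : R) * G u * ((F ((v + u) - τ) : R) * 1 * zch r τ) =
        ∑ v : ZMod p, (W v : R) * zch r v * ((G u : R) * zch r u) * levc r F := by
      intro u
      rw [sum_comm]
      refine sum_congr rfl fun v _ => ?_
      rw [← mul_sum, sum_reflect_zch h1, zch_add h1]
      ring
    rw [sum_congr rfl fun u _ => hu u, sum_sum_factor]
    unfold levc lev
    ring
  have e3 : ∑ τ : ZMod p, ∑ u : ZMod p, ∑ v : ZMod p, (W v : R) * G u * ((F (τ + (u - v)) : R) * 1 * zch r τ) =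
      lev r W * lev r F * levc r G := by
    rw [sum_comm]
    have hu : ∀ u : ZMod p, ∑ τ : ZMod p, ∑ v : ZMod p, (W v : R) * G u * ((F (τ + (u - v)) : R) * 1 * zch r τ) =
        ∑ v : ZMod p, (W v : R) * zch r v * ((G u : R) * zch r (-u)) * lev r F := by
      intro u
      rw [sum_comm]
      refine sum_congr rfl fun v _ => ?_
      rw [← mul_sum, sum_shift_zch h1, neg_sub, show zch r (v - u) = zch r v * zch r (-u) by
        rw [← zch_add h1, sub_eq_add_neg]]
      ring
    rw [sum_congr rfl fun u _ => hu u, sum_sum_factor]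
    unfold levc lev
    ring
  have e4 : ∑ τ : ZMod p, (if s = τ then (1 : R) else 0) * zch r τ = zch r s := by
    simp only [ite_mul, one_mul, zero_mul, sum_ite_eq, mem_univ, if_true]
  rw [e1, e2, e3, e4] at hsum
  exact hsum

/-- `r^{p−1}` is again a "character": `Σ_{i<p} (r^{p−1})^i = 0`. [folklore] -/
theorem geom_sum_pow_pred_eq_zero {r : R} (hr : ∑ i ∈ range p, r ^ i = 0) :
    ∑ i ∈ range p, (r ^ (p - 1)) ^ i = 0 := by
  have hp1 : 1 < p := (Fact.out : p.Prime).one_lt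
  haveI : NeZero p := ⟨by omega⟩
  have hneg : zch r (-1 : ZMod p) = r ^ (p - 1) := by
    rw [zch, ZMod.neg_val, ZMod.val_one, if_neg (one_ne_zero)]
  rw [← hneg]
  exact geom_sum_zch_eq_zero hr (neg_ne_zero.2 one_ne_zero)

/-- `zch (r^{p−1}) s = zch r (−s)`. [folklore] -/
theorem zch_pow_pred {r : R} (h : r ^ p = 1) (s : ZMod p) : zch (r ^ (p - 1)) s = zch r (-s) := by
  rw [zch, ← pow_mul, mul_comm, pow_mul, show r ^ s.val = zch r s from rfl, zch_pow h,
    show ((p - 1 : ℕ) : ZMod p) = -1 by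
      rw [Nat.cast_sub (Fact.out : p.Prime).one_lt.le, Nat.cast_one, ZMod.natCast_self, zero_sub], neg_one_mul]

/-- Evaluating at `r^{p−1}` swaps `lev` and `levc`. [folklore] -/
theorem lev_pow_pred {r : R} (h : r ^ p = 1) (F : ZMod p → ℕ) : lev (r ^ (p - 1)) F = levc r F := by
  unfold lev levc
  exact sum_congr rfl fun v _ => by rw [zch_pow_pred h]

/-- Evaluating at `r^{p−1}` swaps `levc` and `lev`. [folklore] -/
theorem levc_pow_pred {r : R} (h : r ^ p = 1) (F : ZMod p → ℕ) : levc (r ^ (p - 1)) F = lev r F := by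
  unfold lev levc
  exact sum_congr rfl fun v _ => by rw [zch_pow_pred h, neg_neg]

/-- **The conjugate identity** `wx̄ȳ + w̄xȳ + w̄x̄y + r^{−s} = 0`. [folklore] -/
theorem line_char_identity3_conj {r : R} (hr : ∑ i ∈ range p, r ^ i = 0) (W F G : ZMod p → ℕ) (s : ZMod p) (K : ℕ)
    (hid : ∀ τ : ZMod p, (∑ u : ZMod p, lineMat3 W F τ u * G u) + (if s = τ then 1 else 0) = K) :
    lev r W * levc r F * levc r G + levc r W * lev r F * levc r G + levc r W * levc r F * lev r G + zch r (-s) = 0 := by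
  have h1 := pow_eq_one_of_geom_sum_eq_zero hr
  have key := line_char_identity3 (geom_sum_pow_pred_eq_zero hr) W F G s K hid
  rw [lev_pow_pred h1, lev_pow_pred h1, lev_pow_pred h1, levc_pow_pred h1, levc_pow_pred h1, levc_pow_pred h1,
    zch_pow_pred h1] at key
  exact key

end Character

/-! ## The polynomial identities and the local obstruction -/

section Algebra

variable {R : Type*} [CommRing R]

/-- **The norm identity** `D(xw̄, x̄w)·D(yw̄, ȳw) = w̄²u² − ww̄·uū + w²ū²`, `u = w̄xy + wx̄y + wxȳ`, `ū = wx̄ȳ + w̄xȳ + w̄x̄y`.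
[folklore] -/
theorem threeD_mul_threeD (w w' x x' y y' : R) :
    ((x * w') ^ 2 + (x * w') * (x' * w) + (x' * w) ^ 2) * ((y * w') ^ 2 + (y * w') * (y' * w) + (y' * w) ^ 2) =
      w' ^ 2 * (w' * x * y + w * x' * y + w * x * y') ^ 2
        - w * w' * ((w' * x * y + w * x' * y + w * x * y') * (w * x' * y' + w' * x * y' + w' * x' * y))
        + w ^ 2 * (w * x' * y' + w' * x * y' + w' * x' * y) ^ 2 := by
  ring

variable {w w' x x' y y' z z' : R}

/-- On solutions (`u = −z`, `ū = −z'`, `zz' = 1`): `D_X · D_Y = w̄²z² − ww̄ + w²z'²`. [folklore] -/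
theorem threeD_mul_threeD_eq (hu : w' * x * y + w * x' * y + w * x * y' = -z)
    (hu' : w * x' * y' + w' * x * y' + w' * x' * y = -z') (hzz : z * z' = 1) :
    ((x * w') ^ 2 + (x * w') * (x' * w) + (x' * w) ^ 2) * ((y * w') ^ 2 + (y * w') * (y' * w) + (y' * w) ^ 2) = w' ^ 2 * z ^ 2 - w * w' + w ^ 2 * z' ^ 2 := by
  rw [threeD_mul_threeD, hu, hu']
  linear_combination (-(w * w')) * hzz

/-- On solutions: `D_X · y = z'·wx − z·(xw̄ + x̄w)` (mate formula). [folklore] -/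
theorem threeD_mul_lev_eq (hu : w' * x * y + w * x' * y + w * x * y' = -z)
    (hu' : w * x' * y' + w' * x * y' + w' * x' * y = -z') :
    ((x * w') ^ 2 + (x * w') * (x' * w) + (x' * w) ^ 2) * y = z' * (w * x) - z * (x * w' + x' * w) := by
  linear_combination (x * w' + x' * w) * hu - (w * x) * hu'

/-- On solutions: `D_X · ȳ = z·w̄x̄ − z'·(xw̄ + x̄w)` (conjugate mate formula). [folklore] -/
theorem threeD_mul_levc_eq (hu : w' * x * y + w * x' * y + w * x * y' = -z)
    (hu' : w * x' * y' + w' * x * y' + w' * x' * y = -z') :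
    ((x * w') ^ 2 + (x * w') * (x' * w) + (x' * w) ^ 2) * y' = z * (w' * x') - z' * (x * w' + x' * w) := by
  linear_combination (x * w' + x' * w) * hu' - (w' * x') * hu

end Algebra

section Obstruction

variable {p : ℕ} [Fact p.Prime] {R : Type*} [CommRing R]

/-- **The local obstruction.**  If `Σ_{i<p} r^i = 0` and `D(xw̄, x̄w) = 0` in `R`, then a solution `G` of the three-set line
identity with hole `s` forces `w̄²ρ² − ww̄ + w²ρ̄² = 0`, `ρ̄·wx − ρ·(xw̄ + x̄w) = 0` and `ρ·w̄x̄ − ρ̄·(xw̄ + x̄w) = 0`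
(`ρ = r^s`, `ρ̄ = r^{−s}`); so if one of them is non-zero there is no solution. [folklore] -/
theorem no_line_identity3_of_local {r : R} (hr : ∑ i ∈ range p, r ^ i = 0) (W F : ZMod p → ℕ) (s : ZMod p)
    (hD : (lev r F * levc r W) ^ 2 + (lev r F * levc r W) * (levc r F * lev r W) + (levc r F * lev r W) ^ 2 = 0)
    (hne : levc r W ^ 2 * zch r s ^ 2 - lev r W * levc r W + lev r W ^ 2 * zch r (-s) ^ 2 ≠ 0 ∨
      zch r (-s) * (lev r W * lev r F) - zch r s * (lev r F * levc r W + levc r F * lev r W) ≠ 0 ∨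
      zch r s * (levc r W * levc r F) - zch r (-s) * (lev r F * levc r W + levc r F * lev r W) ≠ 0)
    (G : ZMod p → ℕ) (K : ℕ)
    (hid : ∀ τ : ZMod p, (∑ u : ZMod p, lineMat3 W F τ u * G u) + (if s = τ then 1 else 0) = K) : False := by
  have h1 := pow_eq_one_of_geom_sum_eq_zero hr
  have hu : levc r W * lev r F * lev r G + lev r W * levc r F * lev r G + lev r W * lev r F * levc r G = -zch r s :=
    eq_neg_of_add_eq_zero_left (line_char_identity3 hr W F G s K hid)
  have hu' : lev r W * levc r F * levc r G + levc r W * lev r F * levc r G + levc r W * levc r F * lev r G =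
      -zch r (-s) := eq_neg_of_add_eq_zero_left (line_char_identity3_conj hr W F G s K hid)
  have hzz : zch r s * zch r (-s) = 1 := zch_mul_zch_neg h1 s
  rcases hne with h | h | h
  · apply h
    rw [← threeD_mul_threeD_eq (w := lev r W) (w' := levc r W) (x := lev r F) (x' := levc r F) (y := lev r G)
      (y' := levc r G) (by linear_combination hu) (by linear_combination hu') hzz, hD, zero_mul]
  · apply h
    rw [← threeD_mul_lev_eq (w := lev r W) (w' := levc r W) (x := lev r F) (x' := levc r F) (y := lev r G)
      (y' := levc r G) (by linear_combination hu) (by linear_combination hu'), hD, zero_mul]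
  · apply h
    rw [← threeD_mul_levc_eq (w := lev r W) (w' := levc r W) (x := lev r F) (x' := levc r F) (y := lev r G)
      (y' := levc r G) (by linear_combination hu) (by linear_combination hu'), hD, zero_mul]

end Obstruction

end LineUnit

end Summit.MatrixMultiplication.OmegaCensus
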